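import Summits.RiemannHypothesis.RiemannHypothesis.Theorems.JensenLogBandArcDescentR2Kernel
import HarnessLib

/-!
# Sharp global descent in the bounded-radius regime, part 2: the descent (BAND crux, R2 input F6b)

RH ladder column JENSEN, rung J-P(P3) «log band», BAND crux `XiDerivBandRealAllRates`
(stmt-RiemannHypothesis-19913) of route «JensenLogBand», line «band-one-window» (u-arc reshape,
lead rh-jensen-prover g7) — regime-(R2) input for the assembly step (S5) and the far zone of
HOME/rh-jensen-prover/g7-work/LINE-PLAN.md §8.5. RH-FREE `Γ`-factor calculus. WHAT THIS IS NOT: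
nothing here bears on zeros of `ζ` or the truth of RH.

* `norm_xiGammaFactor_arc_le` — `‖γ̃(½+u_θ)‖ ≤ e^{5h+1}·e^{−(n+1)(cos φ₀ − cos θ)}·‖γ̃(½+u*)‖` for
  `|θ| < π/2` (horizontal comparison at rate `≥ ℓ/2 − 1` with `rℓ/2 ≥ (n+1) − (1 + 8h/5)`; vertical
  comparison at rate `≤ 4/5`; both from eng-2 g6 F1/F2);
* **`norm_arcModelIntegrand_le_descent_R2`**: for `|θ| < π/2`, on the saddle circle
  (`r = ‖u* − c‖`, `φ₀ = arg(u* − c)`):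
  `‖I_r(θ)‖ ≤ e^{6h + 2} · ‖I_r(φ₀)‖ · exp(−(n+1)(cos φ₀ − cos θ))`;
* **`norm_arcModelIntegrand_le_descent_R2'`**: `‖I_r(θ)‖ ≤ e^{8h + 3} · ‖I_r(φ₀)‖ · exp(−(n+1)(1 − cos θ))`
  — descent constant EXACTLY `n + 1` against `1 − cos θ`, at the price of a constant `e^{O(h)}`
  (in R2, `h ≤ 20`). USE (S5 in R2 / far zone): at the deep flank `θ = ±π/2` the arc point
  `½ + x + i(T ± r)` lies in the strip, `|ζ| ≤ 32 T^{(½−x)/2} log T = O(ℓ)e^{(n+1)(½−x)/h}`, and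
  `e^{−(n+1)} · e^{(n+1)(½−x)/h} = e^{−(n+1)(h − ½ + x)/h}` is small exactly when `h + x > ½`
  (own centre: `c < 8 ⇔ h > ½`; competitor `x = −a`: near-zone condition `a < h − ½ − δ₁`).

Regime: `|x| ≤ ½`, `T ≥ 100`, `ℓ_T ≥ 20`, `n ≥ 100`, `½ ≤ h ≤ (7/20)T`, **`h ≤ 20`**.
(prover-rh-jensen-eng-2-g6-0, 2026-08-27.)
-/

noncomputable section

-- single-problem summit: `Summit.RiemannHypothesis.RiemannHypothesis.…` is the tree convention
set_option linter.dupNamespace false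

open Complex Real Set

namespace Summit.RiemannHypothesis.RiemannHypothesis.Theorems.JensenPolynomials.LogBandArc

open Literature.NumberTheory.LFunctions

variable {n : ℕ} {x T : ℝ} {u : ℂ}

/-! ## The `Γ`-factor along the saddle circle -/

set_option maxHeartbeats 400000 in -- long chain of explicit estimates in a large context, no search
/-- **`γ̃` along the saddle circle (R2):** for `|θ| < π/2`,
`‖γ̃(½ + u_θ)‖ ≤ e^{5h + 1} · exp(−(n+1)(cos φ₀ − cos θ)) · ‖γ̃(½ + u*)‖` — horizontal comparison
(F1) between the abscissae `½ + x + r cos θ` and `½ + x + r cos φ₀` with rate `≥ ℓ/2 − 1`, where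
`r ℓ/2 ≥ (n+1) − (1 + (8/5)h)`; vertical comparison (F1) between the heights `T + r sin θ` and
`T + Im(u* − c)` at rate `≤ 4/5`. [folklore] -/
theorem norm_xiGammaFactor_arc_le (hx : |x| ≤ 1 / 2) (hT : 100 ≤ T)
    (hℓ : 20 ≤ ell T) (hn : 100 ≤ n) (hh : 1 / 2 ≤ bandRadius n T)
    (hhT : bandRadius n T ≤ 7 / 20 * T) (hH : bandRadius n T ≤ 20)
    (hu : ‖u - ((x : ℂ) + (T : ℂ) * I + bandRadius n T)‖ ≤ 3 / 5 * bandRadius n T)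
    (hS : arcSaddleFn n ((x : ℂ) + (T : ℂ) * I) u = 0) {θ : ℝ} (hθ : |θ| < Real.pi / 2) :
    ‖xiGammaFactor (1 / 2 + circleMap ((x : ℂ) + (T : ℂ) * I) ‖u - ((x : ℂ) + (T : ℂ) * I)‖ θ)‖ ≤
      Real.exp (5 * bandRadius n T + 1) *
        Real.exp (-(((n : ℝ) + 1) * (Real.cos (Complex.arg (u - ((x : ℂ) + (T : ℂ) * I))) -
          Real.cos θ))) * ‖xiGammaFactor (1 / 2 + u)‖ := by
  -- facts first
  obtain ⟨-, hεh, hε33, hT1200, -⟩ := R2_bookkeeping hT hℓ hh hH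
  obtain ⟨hre_lo, him_abs, hr_lo, hr_hi⟩ := arcSaddle_sharp_polar hx hT hℓ hn hh hhT hH hu hS
  have hℓ0 : 0 < ell T := by linarith
  have hεℓ : (2 + 16 / 5 * bandRadius n T) / ell T * ell T = 2 + 16 / 5 * bandRadius n T :=
    div_mul_cancel₀ _ hℓ0.ne'
  have hhℓ : bandRadius n T * ell T = 2 * ((n : ℝ) + 1) := bandRadius_mul_ell hℓ
  have hu_eq : circleMap ((x : ℂ) + (T : ℂ) * I) ‖u - ((x : ℂ) + (T : ℂ) * I)‖
      (Complex.arg (u - ((x : ℂ) + (T : ℂ) * I))) = u := circleMap_norm_arg _ u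
  obtain ⟨hure, huim⟩ := circleMap_sub_re_im ((x : ℂ) + (T : ℂ) * I) ‖u - ((x : ℂ) + (T : ℂ) * I)‖
    (Complex.arg (u - ((x : ℂ) + (T : ℂ) * I)))
  rw [hu_eq] at hure huim
  have hws := half_add_circleMap_eq x T ‖u - ((x : ℂ) + (T : ℂ) * I)‖ θ
  have hss := half_add_circleMap_eq x T ‖u - ((x : ℂ) + (T : ℂ) * I)‖
    (Complex.arg (u - ((x : ℂ) + (T : ℂ) * I)))
  rw [hu_eq] at hss
  -- opaque names
  generalize hε' : (2 + 16 / 5 * bandRadius n T) / ell T = ε at *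
  generalize hh' : bandRadius n T = h at *
  generalize hℓ' : ell T = ℓ at *
  generalize hφ' : Complex.arg (u - ((x : ℂ) + (T : ℂ) * I)) = φ₀ at *
  generalize hr' : ‖u - ((x : ℂ) + (T : ℂ) * I)‖ = r at *
  have hx' := abs_le.1 hx
  have hh0 : 0 < h := by linarith only [hh]
  have hr0 : 0 < r := by linarith only [hr_lo, hεh, hh0]
  have hrhi' : r ≤ 34 / 25 * h := by linarith only [hr_hi, hεh]
  have hrlo' : 16 / 25 * h ≤ r := by linarith only [hr_lo, hεh]
  have hr28 : r ≤ 28 := by linarith only [hrhi', hH]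
  have hcosθ : 0 < Real.cos θ := Real.cos_pos_of_mem_Ioo (abs_lt.1 hθ)
  have hcosθ1 : Real.cos θ ≤ 1 := Real.cos_le_one θ
  have hsinθ : |Real.sin θ| ≤ 1 := Real.abs_sin_le_one θ
  have hsinθ' := abs_le.1 hsinθ
  have hcos0 : 0 < Real.cos φ₀ := by
    have h1 : 0 < r * Real.cos φ₀ := by
      rw [← hure]; linarith only [hre_lo, hh0, hεh]
    exact pos_of_mul_pos_right h1 hr0.le
  have hcos01 : Real.cos φ₀ ≤ 1 := Real.cos_le_one φ₀
  have him_le : |r * Real.sin φ₀| ≤ ε := by rw [← huim]; exact him_abs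
  have him_le' := abs_le.1 him_le
  have hε0 : 0 ≤ ε := (abs_nonneg _).trans him_le
  -- the four coordinates
  obtain ⟨σθ, hσθ⟩ : ∃ s : ℝ, s = 1 / 2 + x + r * Real.cos θ := ⟨_, rfl⟩
  obtain ⟨tθ, htθ⟩ : ∃ s : ℝ, s = T + r * Real.sin θ := ⟨_, rfl⟩
  obtain ⟨σs, hσs⟩ : ∃ s : ℝ, s = 1 / 2 + x + r * Real.cos φ₀ := ⟨_, rfl⟩
  obtain ⟨ts, hts⟩ : ∃ s : ℝ, s = T + r * Real.sin φ₀ := ⟨_, rfl⟩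
  rw [← hσθ, ← htθ] at hws
  rw [← hσs, ← hts] at hss
  rw [hws, hss]
  have hrcosθ : 0 < r * Real.cos θ := mul_pos hr0 hcosθ
  have hrcos0 : 0 < r * Real.cos φ₀ := mul_pos hr0 hcos0
  have hrcosθ1 : r * Real.cos θ ≤ r := mul_le_of_le_one_right hr0.le hcosθ1
  have hrsinθ : r * (-1) ≤ r * Real.sin θ := mul_le_mul_of_nonneg_left hsinθ'.1 hr0.le
  have hrsinθ' : r * Real.sin θ ≤ r * 1 := mul_le_mul_of_nonneg_left hsinθ'.2 hr0.le
  have hσθ0 : 0 < σθ := by rw [hσθ]; linarith only [hrcosθ, hx'.1]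
  have hσs0 : 0 < σs := by rw [hσs]; linarith only [hrcos0, hx'.1]
  have htθlo : T - 32 ≤ tθ := by rw [htθ]; linarith only [hrsinθ, hr28]
  have htθhi : tθ ≤ T + 28 := by rw [htθ]; linarith only [hrsinθ', hr28]
  have htslo : T - 32 ≤ ts := by rw [hts]; linarith only [him_le'.1, hε33]
  have htθ2 : 2 ≤ tθ := by linarith only [htθlo, hT1200]
  have hδc : σs - σθ = r * (Real.cos φ₀ - Real.cos θ) := by rw [hσs, hσθ]; ring
  obtain ⟨hellt, h6t⟩ := ell_height_bounds hT1200 htθlo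
  rw [hℓ'] at hellt
  -- (1) horizontal comparison at height `tθ`
  have hhoriz : ‖xiGammaFactor ((σθ : ℂ) + (tθ : ℂ) * I)‖ ≤
      Real.exp (1 + 3 * h) * Real.exp (-(((n : ℝ) + 1) * (Real.cos φ₀ - Real.cos θ))) *
        ‖xiGammaFactor ((σs : ℂ) + (tθ : ℂ) * I)‖ := by
    have hG0 : 0 ≤ ‖xiGammaFactor ((σs : ℂ) + (tθ : ℂ) * I)‖ := norm_nonneg _
    rcases le_or_gt σθ σs with hle | hgt
    · -- case A: the arc point is left of (or at) the saddle abscissa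
      have h1 := norm_xiGammaFactor_le_of_re_le hσθ0 hle htθ2
      refine h1.trans ?_
      rw [mul_comm]
      refine mul_le_mul_of_nonneg_right ?_ hG0
      rw [← Real.exp_add]
      apply Real.exp_le_exp.2
      have hdc0 : 0 ≤ Real.cos φ₀ - Real.cos θ := by
        have h2 : 0 ≤ r * (Real.cos φ₀ - Real.cos θ) := by rw [← hδc]; linarith only [hle]
        have h3 := div_nonneg h2 hr0.le
        rwa [mul_div_cancel_left₀ _ hr0.ne'] at h3
      have hdc1 : Real.cos φ₀ - Real.cos θ ≤ 1 := by linarith only [hcos01, hcosθ]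
      have hrate : ℓ / 2 - 1 ≤ ell tθ / 2 - 6 / tθ := by linarith only [hellt, h6t]
      have hA : r * (Real.cos φ₀ - Real.cos θ) * (ℓ / 2 - 1) ≤
          (σs - σθ) * (ell tθ / 2 - 6 / tθ) := by
        rw [hδc]
        exact mul_le_mul_of_nonneg_left hrate (mul_nonneg hr0.le hdc0)
      have hrℓ : ((n : ℝ) + 1) - (1 + 8 / 5 * h) ≤ r * ℓ / 2 := by
        have h2 : (h - ε) * ℓ ≤ r * ℓ := mul_le_mul_of_nonneg_right hr_lo hℓ0.le
        have e : (h - ε) * ℓ = h * ℓ - ε * ℓ := by ring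
        linarith only [h2, e, hhℓ, hεℓ]
      have hB : (((n : ℝ) + 1) - (1 + 8 / 5 * h)) * (Real.cos φ₀ - Real.cos θ) ≤
          (r * ℓ / 2) * (Real.cos φ₀ - Real.cos θ) := mul_le_mul_of_nonneg_right hrℓ hdc0
      have hC : (1 + 8 / 5 * h) * (Real.cos φ₀ - Real.cos θ) ≤ 1 + 8 / 5 * h :=
        mul_le_of_le_one_right (by positivity) hdc1
      have hD : r * (Real.cos φ₀ - Real.cos θ) ≤ r := mul_le_of_le_one_right hr0.le hdc1
      have e2 : r * (Real.cos φ₀ - Real.cos θ) * (ℓ / 2 - 1) =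
          (r * ℓ / 2) * (Real.cos φ₀ - Real.cos θ) - r * (Real.cos φ₀ - Real.cos θ) := by ring
      linarith only [hA, hB, hC, hD, e2, hrhi', hh0.le]
    · -- case B: the arc point is (slightly) right of the saddle abscissa
      have h1 := norm_xiGammaFactor_le_of_le_re hσs0 hgt.le htθ2
      refine h1.trans ?_
      rw [mul_comm]
      refine mul_le_mul_of_nonneg_right ?_ hG0
      rw [← Real.exp_add]
      apply Real.exp_le_exp.2
      -- `σθ − σs ≤ ε²/r`
      have hgap : (σθ - σs) * r ≤ ε ^ 2 := by
        have e : σθ - σs = r * (Real.cos θ - Real.cos φ₀) := by rw [hσs, hσθ]; ring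
        rw [e]
        have hcc : Real.cos φ₀ * Real.cos φ₀ ≤ Real.cos φ₀ := mul_le_of_le_one_left hcos0.le hcos01
        have h2 : Real.cos θ - Real.cos φ₀ ≤ 1 - Real.cos φ₀ ^ 2 := by
          rw [pow_two]; linarith only [hcc, hcosθ1]
        have h3 : r * r * (1 - Real.cos φ₀ ^ 2) = (r * Real.sin φ₀) ^ 2 := by
          have hs : Real.sin φ₀ ^ 2 = 1 - Real.cos φ₀ ^ 2 := by
            linarith only [Real.sin_sq_add_cos_sq φ₀]
          rw [mul_pow, hs]; ring
        have h4 : (r * Real.sin φ₀) ^ 2 ≤ ε ^ 2 := by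
          have := pow_le_pow_left₀ (abs_nonneg _) him_le 2
          rwa [sq_abs] at this
        have h5 : r * r * (Real.cos θ - Real.cos φ₀) ≤ r * r * (1 - Real.cos φ₀ ^ 2) :=
          mul_le_mul_of_nonneg_left h2 (mul_nonneg hr0.le hr0.le)
        have e2 : r * (Real.cos θ - Real.cos φ₀) * r = r * r * (Real.cos θ - Real.cos φ₀) := by ring
        linarith only [h5, h3, h4, e2]
      -- the rate is `≤ ℓ/2 + 1`
      have hrate : Real.log ((σθ + tθ) / (2 * π)) / 2 + 6 / tθ ≤ ℓ / 2 + 1 := by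
        have hsum : σθ + tθ ≤ T + 57 := by rw [hσθ]; linarith only [hrcosθ1, htθhi, hx'.2, hr28]
        have hT0 : 0 < T := by linarith only [hT1200]
        have hlog : Real.log ((σθ + tθ) / (2 * π)) ≤ Real.log ((T + 57) / (2 * π)) :=
          Real.log_le_log (by positivity) (by gcongr)
        have hsplit : Real.log ((T + 57) / (2 * π)) = ℓ + Real.log ((T + 57) / T) := by
          rw [← hℓ', ell, ← Real.log_mul (by positivity) (by positivity)]
          congr 1; field_simp
        have hsmall : Real.log ((T + 57) / T) ≤ 57 / T := by
          have := Real.log_le_sub_one_of_pos (show 0 < (T + 57) / T by positivity)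
          have e : (T + 57) / T - 1 = 57 / T := by field_simp; ring
          linarith only [this, e]
        have h57 : 57 / T ≤ 1 / 20 := by rw [div_le_iff₀ hT0]; linarith only [hT1200]
        linarith only [hlog, hsplit, hsmall, h57, h6t]
      have hrate0 : 0 ≤ Real.log ((σθ + tθ) / (2 * π)) / 2 + 6 / tθ := by
        have hsum0 : 2 * π ≤ σθ + tθ := by
          linarith only [htθlo, hT1200, hσθ0, Real.pi_lt_d2]
        have h2 : 0 ≤ Real.log ((σθ + tθ) / (2 * π)) :=
          Real.log_nonneg ((one_le_div (by positivity)).2 hsum0)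
        have h3 : 0 ≤ 6 / tθ := by positivity
        linarith only [h2, h3]
      have hgap0 : 0 ≤ σθ - σs := by linarith only [hgt]
      -- `(σθ − σs)·rate ≤ (σθ − σs)(ℓ/2 + 1) ≤ (ε²/r)(ℓ/2 + 1) ≤ 3/5 + (6/5) h`
      have hstep1 : (σθ - σs) * (Real.log ((σθ + tθ) / (2 * π)) / 2 + 6 / tθ) ≤
          (σθ - σs) * (ℓ / 2 + 1) := mul_le_mul_of_nonneg_left hrate hgap0
      have hstep2 : (σθ - σs) * (ℓ / 2 + 1) * r ≤ ε ^ 2 * (ℓ / 2 + 1) := by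
        have := mul_le_mul_of_nonneg_right hgap (show 0 ≤ ℓ / 2 + 1 by positivity)
        linarith only [this]
      have hstep3 : ε ^ 2 * (ℓ / 2 + 1) ≤ (3 / 5 + 6 / 5 * h) * r := by
        -- `ε² ℓ/2 = ε (εℓ)/2 = ε (1 + 8h/5)`, `ε ≤ 9h/25`, `r ≥ 16h/25`
        have e1 : ε ^ 2 * (ℓ / 2 + 1) = ε * (ε * ℓ) / 2 + ε * ε := by ring
        rw [e1, hεℓ]
        have a1 : ε * (2 + 16 / 5 * h) / 2 ≤ 9 / 25 * h * (2 + 16 / 5 * h) / 2 := by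
          have := mul_le_mul_of_nonneg_right hεh (show 0 ≤ (2 + 16 / 5 * h) / 2 by positivity)
          linarith only [this]
        have a2 : ε * ε ≤ 9 / 25 * h * (9 / 25 * h) :=
          mul_le_mul hεh hεh hε0 (by positivity)
        have a3 : (3 / 5 + 6 / 5 * h) * (16 / 25 * h) ≤ (3 / 5 + 6 / 5 * h) * r :=
          mul_le_mul_of_nonneg_left hrlo' (by positivity)
        nlinarith only [a1, a2, a3, hh0]
      -- in case B `(n+1)(cos φ₀ − cos θ) ≤ 0`
      have hdc : ((n : ℝ) + 1) * (Real.cos φ₀ - Real.cos θ) ≤ 0 := by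
        have h2 : r * (Real.cos φ₀ - Real.cos θ) < 0 := by rw [← hδc]; linarith only [hgt]
        have h3 : Real.cos φ₀ - Real.cos θ < 0 := by
          rcases lt_or_ge (Real.cos φ₀ - Real.cos θ) 0 with h3 | hc
          · exact h3
          · have := mul_nonneg hr0.le hc
            linarith only [this, h2]
        have h4 : 0 ≤ ((n : ℝ) + 1) * -(Real.cos φ₀ - Real.cos θ) :=
          mul_nonneg (by positivity) (by linarith only [h3])
        linarith only [h4]
      -- combine (multiply the chain by `r > 0`)
      have hchain : (σθ - σs) * (Real.log ((σθ + tθ) / (2 * π)) / 2 + 6 / tθ) * r ≤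
          (3 / 5 + 6 / 5 * h) * r := by
        have := mul_le_mul_of_nonneg_right hstep1 hr0.le
        linarith only [this, hstep2, hstep3]
      have hfin : (σθ - σs) * (Real.log ((σθ + tθ) / (2 * π)) / 2 + 6 / tθ) ≤ 3 / 5 + 6 / 5 * h :=
        le_of_mul_le_mul_right hchain hr0
      linarith only [hfin, hdc, hh0]
  -- (2) vertical comparison at abscissa `σs`
  have hvert : ‖xiGammaFactor ((σs : ℂ) + (tθ : ℂ) * I)‖ ≤
      ‖xiGammaFactor ((σs : ℂ) + (ts : ℂ) * I)‖ * Real.exp (7 / 5 * h) := by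
    have h1 := norm_xiGammaFactor_vertical_le_symm (σ := σs) (t := ts) (t' := tθ) (t₀ := T - 32)
      hσs0 (by linarith only [hT1200]) htslo htθlo
    refine h1.trans (mul_le_mul_of_nonneg_left (Real.exp_le_exp.2 ?_) (norm_nonneg _))
    have hdt : |tθ - ts| ≤ 43 / 25 * h := by
      rw [htθ, hts, show T + r * Real.sin θ - (T + r * Real.sin φ₀) =
        r * Real.sin θ - r * Real.sin φ₀ by ring]
      refine (abs_sub _ _).trans ?_
      have h2 : |r * Real.sin θ| ≤ r := by
        rw [abs_mul, abs_of_pos hr0]; exact mul_le_of_le_one_right hr0.le hsinθ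
      linarith only [h2, him_le, hrhi', hεh]
    have h6 : 6 / (T - 32) ≤ 1 / 100 := by
      rw [div_le_iff₀ (by linarith only [hT1200])]; linarith only [hT1200]
    have hrate : π / 4 + 6 / (T - 32) ≤ 4 / 5 := by linarith only [Real.pi_lt_d2, h6]
    have hrate0 : 0 ≤ π / 4 + 6 / (T - 32) := by
      have : 0 ≤ 6 / (T - 32) := div_nonneg (by norm_num) (by linarith only [hT1200])
      linarith only [this, Real.pi_pos]
    calc (π / 4 + 6 / (T - 32)) * |tθ - ts| ≤ 4 / 5 * (43 / 25 * h) :=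
          mul_le_mul hrate hdt (abs_nonneg _) (by norm_num)
      _ ≤ 7 / 5 * h := by linarith only [hh0]
  -- (3) combine
  have hE0 : 0 ≤ Real.exp (-(((n : ℝ) + 1) * (Real.cos φ₀ - Real.cos θ))) := (Real.exp_pos _).le
  have hP0 : 0 ≤ Real.exp (1 + 3 * h) * Real.exp (-(((n : ℝ) + 1) * (Real.cos φ₀ - Real.cos θ))) :=
    mul_nonneg (Real.exp_pos _).le hE0
  calc ‖xiGammaFactor ((σθ : ℂ) + (tθ : ℂ) * I)‖
      ≤ Real.exp (1 + 3 * h) * Real.exp (-(((n : ℝ) + 1) * (Real.cos φ₀ - Real.cos θ))) *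
          ‖xiGammaFactor ((σs : ℂ) + (tθ : ℂ) * I)‖ := hhoriz
    _ ≤ Real.exp (1 + 3 * h) * Real.exp (-(((n : ℝ) + 1) * (Real.cos φ₀ - Real.cos θ))) *
          (‖xiGammaFactor ((σs : ℂ) + (ts : ℂ) * I)‖ * Real.exp (7 / 5 * h)) :=
        mul_le_mul_of_nonneg_left hvert hP0
    _ = (Real.exp (1 + 3 * h) * Real.exp (7 / 5 * h)) *
          Real.exp (-(((n : ℝ) + 1) * (Real.cos φ₀ - Real.cos θ))) *
          ‖xiGammaFactor ((σs : ℂ) + (ts : ℂ) * I)‖ := by ring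
    _ ≤ Real.exp (5 * h + 1) * Real.exp (-(((n : ℝ) + 1) * (Real.cos φ₀ - Real.cos θ))) *
          ‖xiGammaFactor ((σs : ℂ) + (ts : ℂ) * I)‖ := by
        apply mul_le_mul_of_nonneg_right _ (norm_nonneg _)
        apply mul_le_mul_of_nonneg_right _ hE0
        rw [← Real.exp_add]
        exact Real.exp_le_exp.2 (by linarith only [hh0])

/-! ## The sharp descent -/

/-- **Sharp global descent in regime R2.** Under the S3 regime with bounded band radius
`h = h(n,T) ≤ 20`, for a zero `u*` of `S_{n,c}` in the disc and every `|θ| < π/2`, on the saddle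
circle `r = ‖u* − c‖`, `φ₀ = arg(u* − c)`:
`‖I_r(θ)‖ ≤ e^{6h + 2} · ‖I_r(φ₀)‖ · exp(−(n+1)(cos φ₀ − cos θ))`. [folklore] -/
theorem norm_arcModelIntegrand_le_descent_R2 (hx : |x| ≤ 1 / 2) (hT : 100 ≤ T)
    (hℓ : 20 ≤ ell T) (hn : 100 ≤ n) (hh : 1 / 2 ≤ bandRadius n T)
    (hhT : bandRadius n T ≤ 7 / 20 * T) (hH : bandRadius n T ≤ 20)
    (hu : ‖u - ((x : ℂ) + (T : ℂ) * I + bandRadius n T)‖ ≤ 3 / 5 * bandRadius n T)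
    (hS : arcSaddleFn n ((x : ℂ) + (T : ℂ) * I) u = 0) {θ : ℝ} (hθ : |θ| < Real.pi / 2) :
    ‖arcModelIntegrand n ‖u - ((x : ℂ) + (T : ℂ) * I)‖ ((x : ℂ) + (T : ℂ) * I) θ‖ ≤
      Real.exp (6 * bandRadius n T + 2) *
        ‖arcModelIntegrand n ‖u - ((x : ℂ) + (T : ℂ) * I)‖ ((x : ℂ) + (T : ℂ) * I)
          (Complex.arg (u - ((x : ℂ) + (T : ℂ) * I)))‖ *
        Real.exp (-(((n : ℝ) + 1) *
          (Real.cos (Complex.arg (u - ((x : ℂ) + (T : ℂ) * I))) - Real.cos θ))) := by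
  have hK := norm_sqKernel_le_of_mem_sphere hx hT hℓ hn hh hhT hH hu hS θ
  have hG := norm_xiGammaFactor_arc_le hx hT hℓ hn hh hhT hH hu hS hθ
  rw [norm_arcModelIntegrand_eq, norm_arcModelIntegrand_eq, circleMap_norm_arg]
  have hr : 0 ≤ |‖u - ((x : ℂ) + (T : ℂ) * I)‖| := abs_nonneg _
  have hγ0 : 0 ≤ ‖xiGammaFactor (1 / 2 + u)‖ := norm_nonneg _
  have hK0 : 0 ≤ ‖sqKernel n ((x : ℂ) + (T : ℂ) * I) u‖ := norm_nonneg _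
  set E := Real.exp (-(((n : ℝ) + 1) *
    (Real.cos (Complex.arg (u - ((x : ℂ) + (T : ℂ) * I))) - Real.cos θ))) with hE
  have hE0 : 0 ≤ E := (Real.exp_pos _).le
  calc |‖u - ((x : ℂ) + (T : ℂ) * I)‖| *
        (‖xiGammaFactor (1 / 2 + circleMap ((x : ℂ) + (T : ℂ) * I) ‖u - ((x : ℂ) + (T : ℂ) * I)‖ θ)‖ *
          ‖sqKernel n ((x : ℂ) + (T : ℂ) * I)
            (circleMap ((x : ℂ) + (T : ℂ) * I) ‖u - ((x : ℂ) + (T : ℂ) * I)‖ θ)‖)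
      ≤ |‖u - ((x : ℂ) + (T : ℂ) * I)‖| *
          ((Real.exp (5 * bandRadius n T + 1) * E * ‖xiGammaFactor (1 / 2 + u)‖) *
            (Real.exp (bandRadius n T / 4 + 1 / 20) * ‖sqKernel n ((x : ℂ) + (T : ℂ) * I) u‖)) := by
        gcongr
    _ = (Real.exp (5 * bandRadius n T + 1) * Real.exp (bandRadius n T / 4 + 1 / 20)) *
          (|‖u - ((x : ℂ) + (T : ℂ) * I)‖| *
            (‖xiGammaFactor (1 / 2 + u)‖ * ‖sqKernel n ((x : ℂ) + (T : ℂ) * I) u‖)) * E := by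
        ring
    _ ≤ Real.exp (6 * bandRadius n T + 2) *
          (|‖u - ((x : ℂ) + (T : ℂ) * I)‖| *
            (‖xiGammaFactor (1 / 2 + u)‖ * ‖sqKernel n ((x : ℂ) + (T : ℂ) * I) u‖)) * E := by
        gcongr
        rw [← Real.exp_add]
        exact Real.exp_le_exp.2 (by linarith)

/-- **Sharp global descent in regime R2, `1 − cos θ` form:**
`‖I_r(θ)‖ ≤ e^{8h + 3} · ‖I_r(φ₀)‖ · exp(−(n+1)(1 − cos θ))` for `|θ| < π/2` — descent constant
exactly `n + 1` (the saddle angle costs only `(n+1)(1 − cos φ₀) ≤ 0.88 + 1.41 h`). [folklore] -/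
theorem norm_arcModelIntegrand_le_descent_R2' (hx : |x| ≤ 1 / 2) (hT : 100 ≤ T)
    (hℓ : 20 ≤ ell T) (hn : 100 ≤ n) (hh : 1 / 2 ≤ bandRadius n T)
    (hhT : bandRadius n T ≤ 7 / 20 * T) (hH : bandRadius n T ≤ 20)
    (hu : ‖u - ((x : ℂ) + (T : ℂ) * I + bandRadius n T)‖ ≤ 3 / 5 * bandRadius n T)
    (hS : arcSaddleFn n ((x : ℂ) + (T : ℂ) * I) u = 0) {θ : ℝ} (hθ : |θ| < Real.pi / 2) :
    ‖arcModelIntegrand n ‖u - ((x : ℂ) + (T : ℂ) * I)‖ ((x : ℂ) + (T : ℂ) * I) θ‖ ≤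
      Real.exp (8 * bandRadius n T + 3) *
        ‖arcModelIntegrand n ‖u - ((x : ℂ) + (T : ℂ) * I)‖ ((x : ℂ) + (T : ℂ) * I)
          (Complex.arg (u - ((x : ℂ) + (T : ℂ) * I)))‖ *
        Real.exp (-(((n : ℝ) + 1) * (1 - Real.cos θ))) := by
  have hmain := norm_arcModelIntegrand_le_descent_R2 hx hT hℓ hn hh hhT hH hu hS hθ
  have hkey := saddle_angle_cost hx hT hℓ hn hh hhT hH hu hS
  have hh0 : 0 < bandRadius n T := by linarith only [hh]
  generalize hh' : bandRadius n T = h at *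
  generalize hφ' : Complex.arg (u - ((x : ℂ) + (T : ℂ) * I)) = φ₀ at *
  generalize hr' : ‖u - ((x : ℂ) + (T : ℂ) * I)‖ = r at *
  generalize hI' : ‖arcModelIntegrand n r ((x : ℂ) + (T : ℂ) * I) θ‖ = A at *
  generalize hI0' : ‖arcModelIntegrand n r ((x : ℂ) + (T : ℂ) * I) φ₀‖ = A₀ at *
  have hA₀ : 0 ≤ A₀ := by rw [← hI0']; exact norm_nonneg _
  -- `exp(−(n+1)(cos φ₀ − cos θ)) = exp(−(n+1)(1 − cos θ)) · exp((n+1)(1 − cos φ₀))`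
  have hsplit : Real.exp (-(((n : ℝ) + 1) * (Real.cos φ₀ - Real.cos θ))) =
      Real.exp (-(((n : ℝ) + 1) * (1 - Real.cos θ))) * Real.exp (((n : ℝ) + 1) * (1 - Real.cos φ₀)) := by
    rw [← Real.exp_add]; congr 1; ring
  rw [hsplit] at hmain
  have hE1 : Real.exp (((n : ℝ) + 1) * (1 - Real.cos φ₀)) ≤ Real.exp (22 / 25 + 141 / 100 * h) :=
    Real.exp_le_exp.2 hkey
  calc A ≤ Real.exp (6 * h + 2) * A₀ *
        (Real.exp (-(((n : ℝ) + 1) * (1 - Real.cos θ))) * Real.exp (((n : ℝ) + 1) * (1 - Real.cos φ₀))) :=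
        hmain
    _ ≤ Real.exp (6 * h + 2) * A₀ *
        (Real.exp (-(((n : ℝ) + 1) * (1 - Real.cos θ))) * Real.exp (22 / 25 + 141 / 100 * h)) := by
        gcongr
    _ = (Real.exp (6 * h + 2) * Real.exp (22 / 25 + 141 / 100 * h)) * A₀ *
        Real.exp (-(((n : ℝ) + 1) * (1 - Real.cos θ))) := by ring
    _ ≤ Real.exp (8 * h + 3) * A₀ * Real.exp (-(((n : ℝ) + 1) * (1 - Real.cos θ))) := by
        gcongr
        rw [← Real.exp_add]
        exact Real.exp_le_exp.2 (by linarith)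

end Summit.RiemannHypothesis.RiemannHypothesis.Theorems.JensenPolynomials.LogBandArc

end
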